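import Literature.MathematicalPhysics.QuantumFieldTheory.ONArchipelagoTermwise
import Literature.MathematicalPhysics.QuantumFieldTheory.ConformalBootstrap3D.MixedEvenTail
import HarnessLib

/-!
# The identity and the singlet-row tail of an `O(N)` archipelago point certificate in closed form; the schema

Fifth file of the archipelago rung.  The `S` rows of Kos–Poland–Simmons-Duffin–Vichi 2015 §2.2 are
`2×2` forms; for a point 7-vector `ofPoints z z̄ w` their term forms `q_{E,j}(a,b) = a² X + b² Y + ab Z`
(`singletTermForm`, previous file) have the entries
`X = Φ²₋(Δ_φ) + Φ³₊(Δ_φ)` — a TWO-WEIGHT evaluation with `(c, d) = (w₁ + w₂, w₁ − w₂)`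
(`sum45_eq_twoWeightEval` of the `σ–ε` chain), `Y = Φ⁴₋(Δ_s)` (one weight), `Z = Φ⁶₋(h) + Φ⁷₊(h)`
(two-weight, `(w₅ + w₆, w₅ − w₆)`), `h = (Δ_φ+Δ_s)/2`.  Exactly as for the even sector of the `σ–ε`
system (`MixedEvenTail.lean`, whose `X` entry has one weight), the obligations with infinitely many
blocks reduce to finitely many closed-form inequalities between the certificate's own numbers,
uniformly on a box `Q ⊆ [φ_lo, φ_hi] × [s_lo, s_hi]`:

* rule (M) for the `S` rows: corner numbers `x = cornerBound₂(w₁+w₂, w₁−w₂; Δ_φ-range)`,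
  `y = termCornerBound(w₃; Δ_s-range)`, `z_∓ = cornerBound₂(±(w₅+w₆), ±(w₅−w₆); h-range)` and the checks
  `x ≥ 0`, `y ≥ 0`, `max(|z₋|,|z₊|)² ≤ 4xy` per box `E ∈ [E₁, E₂]` (`singletTermForm_nonneg_of_cornerBounds`);
* rule (T) for the `S` rows: apex numbers `X_T = (w₁ₐ + w₂ₐ) vₐ^{φ_hi} − R(w₁; φ_lo, E_T) − R(w₂; φ_lo, E_T)`,
  `Y_T = w₃ₐ vₐ^{s_hi} − R(w₃; s_lo, E_T)`, `Z_T = |w₅ₐ + w₆ₐ| vₐ^{h_lo} + R(w₅; h_lo, E_T) + R(w₆; h_lo, E_T)`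
  (`w₁ₐ + w₂ₐ ≥ 0`, `w₃ₐ ≥ 0`) and `X_T, Y_T ≥ 0`, `Z_T² ≤ 4 X_T Y_T` give every term form with `E ≥ E_T`,
  `j ≤ E` PSD (`singletTermForm_nonneg_of_apex`; the two-sided apex estimate
  `abs_pointFunctional_crossF_zMono_sub_apex_le` at signs `∓1`);
* the identity `(I)` from three corner numbers (`identityTerm_ofPoints`, `identityTerm_ofPoints_pos_of_cornerBounds`);
* the singlet tail `Δ ≥ E₀`, every spin, regular or not (`tail_singletPositive_of_termwise_regular`,
  `tail_singletPositive_of_boxes_and_apex`; twist-gap domain `j + τ ≤ E` for (M); non-regular points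
  by `singletPositive_ofPoints_of_eventually_right`).  This discharges the item `tail_S` of
  `ArchipelagoObligations` (which asks only even spins).

Finally the SCHEMA `boxExcluded_of_archipelagoPointRules`: (I) by corner numbers, the `S` sector by light
obligations below `E₀` plus (M)/(T), and the `T`, `A`, `V` rows and the external form as hypotheses in
the shape of `IsPositiveAt` — the `T` / `A` rows are two-sign rows (`tensorTerm_eq_twoSign`,
`antiTerm_eq_twoSign`) served by `ConformalBootstrap3D/TwoSignRows.lean`, the `V` rows are the `σ–ε` odd
rows through the bridge (`vectorPositive_ofPoints_iff`) — give `BoxExcluded N A Q`.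
What this file does NOT contain: any table or number.  Elementary real inequalities throughout.

Sources: arXiv:1504.07997 §2.2 (`KosPolandSimmonsDuffinVichi2015`); M. Hogervorst, S. Rychkov,
Phys. Rev. D 87 (2013) 106004, §3 eqs. (3.6), (3.9) (`HogervorstRychkov2013`).
-/

noncomputable section

namespace Literature.MathematicalPhysics.QuantumFieldTheory.ONArchipelagoSystem

open Finset Set Filter Topology
open ConformalBootstrap3D (IsConformalBlock3D IsRegularPoint3D unitarityBound3D accidentalDegeneracy3D
  crossF pointFunctional pointFunctional_apply zMono zMono_nonneg zMono_zero_zero InDescendantRange twoWeightEval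
  sum45_eq_twoWeightEval twoWeightEval_neg cornerBound₂ cornerBound₂_le termCornerBound
  termCornerBound_le apexRest apexRest_nonneg apexRest_anti_exponent apexRest_anti_level
  abs_pointFunctional_crossF_zMono_sub_apex_le apex_bounds_pointFunctional_crossF_zMono
  natCast_add_le_of_unitarityBound3D_lt natCast_add_half_le_unitarityBound3D
  eventually_isRegularPoint3D_nhdsGT_of_bound_le)

namespace ArchipelagoFunctional

/-! ### The identity (I) in closed form -/

/-- **The identity term of a point 7-vector in closed form**:
`identityTerm = (φ_{w₁}[F^{Δφ}_-[1]] + φ_{w₂}[F^{Δφ}_+[1]]) + φ_{w₃}[F^{Δs}_-[1]] + (φ_{w₅}[F^{h}_-[1]] + φ_{w₆}[F^{h}_+[1]])`,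
the two brackets as two-weight evaluations. [cite: KosPolandSimmonsDuffinVichi2015, §2.1 (unit operator contribution)] -/
theorem identityTerm_ofPoints {N : ℕ} (z zb : Fin N → ℝ) (w : Fin 7 → Fin N → ℝ) (Δφ Δs : ℝ) :
    (ofPoints z zb w).identityTerm Δφ Δs =
      twoWeightEval (w 1 + w 2) (w 1 - w 2) z zb Δφ (zMono 0 0) +
        pointFunctional (w 3) z zb (crossF Δs (-1) (zMono 0 0)) +
        twoWeightEval (w 5 + w 6) (w 5 - w 6) z zb ((Δφ + Δs) / 2) (zMono 0 0) := by
  rw [zMono_zero_zero, ← sum45_eq_twoWeightEval, ← sum45_eq_twoWeightEval]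
  simp only [identityTerm, ofPoints]
  ring

/-- **(I) on a box from three corner numbers** (`Q ⊆ [φ_lo,φ_hi] × [s_lo,s_hi]`). Elementary.
[cite: HogervorstRychkov2013, §3 eq. (3.6)] -/
theorem identityTerm_ofPoints_pos_of_cornerBounds {N : ℕ} (z zb : Fin N → ℝ)
    (w : Fin 7 → Fin N → ℝ) (hz : ∀ k, z k ∈ Ioo (0 : ℝ) 1) (hzb : ∀ k, zb k ∈ Ioo (0 : ℝ) 1)
    {Q : Set (ℝ × ℝ)} {φlo φhi slo shi : ℝ}
    (hQ : ∀ p ∈ Q, (φlo ≤ p.1 ∧ p.1 ≤ φhi) ∧ (slo ≤ p.2 ∧ p.2 ≤ shi))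
    (hI : 0 < cornerBound₂ (w 1 + w 2) (w 1 - w 2) z zb 0 0 0 φlo φhi +
      termCornerBound (w 3) z zb 0 0 0 slo shi +
      cornerBound₂ (w 5 + w 6) (w 5 - w 6) z zb 0 0 0 ((φlo + slo) / 2) ((φhi + shi) / 2)) :
    ∀ p ∈ Q, 0 < (ofPoints z zb w).identityTerm p.1 p.2 := by
  intro p hp
  rw [identityTerm_ofPoints]
  obtain ⟨hφ, hσ⟩ := hQ p hp
  have hs : (p.1 + p.2) / 2 ∈ Icc ((φlo + slo) / 2) ((φhi + shi) / 2) :=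
    ⟨by linarith [hφ.1, hσ.1], by linarith [hφ.2, hσ.2]⟩
  have h1 := cornerBound₂_le (w 1 + w 2) (w 1 - w 2) z zb hz hzb 0 (E := 0) ⟨le_rfl, le_rfl⟩ ⟨hφ.1, hφ.2⟩
  have h3 := termCornerBound_le (w 3) z zb hz hzb 0 (E := 0) ⟨le_rfl, le_rfl⟩ ⟨hσ.1, hσ.2⟩
  have h5 := cornerBound₂_le (w 5 + w 6) (w 5 - w 6) z zb hz hzb 0 (E := 0) ⟨le_rfl, le_rfl⟩ hs
  linarith

/-! ### Rule (M) for the singlet rows: one box, four numbers -/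

/-- **(M), singlet rows.** On the box `E ∈ [E₁, E₂]`, `Δ_φ ∈ [φ_lo, φ_hi]`, `Δ_s ∈ [s_lo, s_hi]`
(so `h ∈ [(φ_lo+s_lo)/2, (φ_hi+s_hi)/2]`): with the corner numbers
`x = cornerBound₂(w₁+w₂, w₁−w₂; φ)` (`≤ Φ²₋+Φ³₊`), `y = termCornerBound(w₃; s)` (`≤ Φ⁴₋`),
`z₋ = cornerBound₂(w₅+w₆, w₅−w₆; h)` (`≤ Z`) and `z₊ = cornerBound₂(−(w₅+w₆), −(w₅−w₆); h)` (`≤ −Z`),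
the checks `x ≥ 0`, `y ≥ 0`, `max(|z₋|,|z₊|)² ≤ 4xy` give the singlet term form PSD on the whole box.
Elementary. [cite: HogervorstRychkov2013, §3 eq. (3.6)] -/
theorem singletTermForm_nonneg_of_cornerBounds {N : ℕ} (z zb : Fin N → ℝ) (w : Fin 7 → Fin N → ℝ)
    (hz : ∀ k, z k ∈ Ioo (0 : ℝ) 1) (hzb : ∀ k, zb k ∈ Ioo (0 : ℝ) 1) (j : ℕ)
    {E₁ E₂ φlo φhi slo shi : ℝ}
    (hX : 0 ≤ cornerBound₂ (w 1 + w 2) (w 1 - w 2) z zb j E₁ E₂ φlo φhi)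
    (hY : 0 ≤ termCornerBound (w 3) z zb j E₁ E₂ slo shi)
    (hZ : max |cornerBound₂ (w 5 + w 6) (w 5 - w 6) z zb j E₁ E₂ ((φlo + slo) / 2) ((φhi + shi) / 2)|
          |cornerBound₂ (-(w 5 + w 6)) (-(w 5 - w 6)) z zb j E₁ E₂ ((φlo + slo) / 2)
            ((φhi + shi) / 2)| ^ 2 ≤
        4 * cornerBound₂ (w 1 + w 2) (w 1 - w 2) z zb j E₁ E₂ φlo φhi *
          termCornerBound (w 3) z zb j E₁ E₂ slo shi) :
    ∀ E ∈ Icc E₁ E₂, ∀ Δφ ∈ Icc φlo φhi, ∀ Δs ∈ Icc slo shi, ∀ x y : ℝ,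
      0 ≤ singletTermForm z zb w Δφ Δs E j x y := by
  intro E hE Δφ hφ Δs hσ x y
  set xlo := cornerBound₂ (w 1 + w 2) (w 1 - w 2) z zb j E₁ E₂ φlo φhi
  set ylo := termCornerBound (w 3) z zb j E₁ E₂ slo shi
  set zm := cornerBound₂ (w 5 + w 6) (w 5 - w 6) z zb j E₁ E₂ ((φlo + slo) / 2) ((φhi + shi) / 2)
  set zp := cornerBound₂ (-(w 5 + w 6)) (-(w 5 - w 6)) z zb j E₁ E₂ ((φlo + slo) / 2)
    ((φhi + shi) / 2)
  have hs : (Δφ + Δs) / 2 ∈ Icc ((φlo + slo) / 2) ((φhi + shi) / 2) :=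
    ⟨by linarith [hφ.1, hσ.1], by linarith [hφ.2, hσ.2]⟩
  set X := pointFunctional (w 1) z zb (crossF Δφ (-1) (zMono E j)) +
    pointFunctional (w 2) z zb (crossF Δφ 1 (zMono E j))
  have hXeq : X = twoWeightEval (w 1 + w 2) (w 1 - w 2) z zb Δφ (zMono E j) :=
    sum45_eq_twoWeightEval _ _ z zb _ _
  have hXle : xlo ≤ X := by rw [hXeq]; exact cornerBound₂_le _ _ z zb hz hzb j hE hφ
  have hYle : ylo ≤ pointFunctional (w 3) z zb (crossF Δs (-1) (zMono E j)) :=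
    termCornerBound_le (w 3) z zb hz hzb j hE hσ
  set Z := pointFunctional (w 5) z zb (crossF ((Δφ + Δs) / 2) (-1) (zMono E j)) +
    pointFunctional (w 6) z zb (crossF ((Δφ + Δs) / 2) 1 (zMono E j))
  have hZeq : Z = twoWeightEval (w 5 + w 6) (w 5 - w 6) z zb ((Δφ + Δs) / 2) (zMono E j) :=
    sum45_eq_twoWeightEval _ _ z zb _ _
  have hZlo : zm ≤ Z := by rw [hZeq]; exact cornerBound₂_le _ _ z zb hz hzb j hE hs
  have hZhi : Z ≤ -zp := by
    have h := cornerBound₂_le (-(w 5 + w 6)) (-(w 5 - w 6)) z zb hz hzb j hE hs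
    rw [twoWeightEval_neg, ← hZeq] at h
    linarith
  set m := max |zm| |zp|
  have hm1 : -m ≤ Z := by
    have : -|zm| ≤ zm := neg_abs_le _
    linarith [le_max_left |zm| |zp|]
  have hm2 : Z ≤ m := by
    have : -zp ≤ |zp| := by rw [← abs_neg]; exact le_abs_self _
    linarith [le_max_right |zm| |zp|]
  have hZsq : Z ^ 2 ≤ m ^ 2 := sq_le_sq' hm1 hm2
  refine singletTermForm_nonneg_of_det z zb w (hX.trans hXle) (hY.trans hYle) ?_ x y
  calc Z ^ 2 ≤ m ^ 2 := hZsq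
    _ ≤ 4 * xlo * ylo := hZ
    _ ≤ 4 * X * pointFunctional (w 3) z zb (crossF Δs (-1) (zMono E j)) :=
        mul_le_mul (mul_le_mul_of_nonneg_left hXle (by norm_num)) hYle hY
          (mul_nonneg (by norm_num) (hX.trans hXle))

/-! ### Rule (T) for the singlet rows: the two-sided apex estimate -/

/-- **(T), singlet rows.** With `v_a = (1-z_a)(1-z̄_a)`, `h_lo = (φ_lo+s_lo)/2` and the apex numbers
`X_T = (w₁ₐ + w₂ₐ) v_a^{φ_hi} − R(w₁; φ_lo, E_T) − R(w₂; φ_lo, E_T)`, `Y_T = w₃ₐ v_a^{s_hi} − R(w₃; s_lo, E_T)`,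
`Z_T = |w₅ₐ + w₆ₐ| v_a^{h_lo} + R(w₅; h_lo, E_T) + R(w₆; h_lo, E_T)` (`w₁ₐ + w₂ₐ ≥ 0`, `w₃ₐ ≥ 0`), the
checks `X_T ≥ 0`, `Y_T ≥ 0`, `Z_T² ≤ 4 X_T Y_T` give the singlet term form PSD for every real `E ≥ E_T`,
every `j ≤ E` and every `(Δ_φ, Δ_s)` in the box (dominated node configuration with apex `a`).
Elementary. [cite: HogervorstRychkov2013, §3 eq. (3.6)] -/
theorem singletTermForm_nonneg_of_apex {N : ℕ} (z zb : Fin N → ℝ) (w : Fin 7 → Fin N → ℝ)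
    (hz : ∀ k, z k ∈ Ioo (0 : ℝ) 1) (hzb : ∀ k, zb k ∈ Ioo (0 : ℝ) 1) (hord : ∀ k, zb k ≤ z k)
    (a : Fin N) (qd qr : Fin N → ℝ) (hqd : ∀ k, 0 < qd k ∧ qd k ≤ 1)
    (hqr : ∀ k, 0 < qr k ∧ qr k ≤ 1)
    (hdomd : ∀ k, z k * zb k ≤ qd k ^ 2 * (z a * zb a) ∧ z k ≤ qd k * z a)
    (hdomr : ∀ k, (1 - z k) * (1 - zb k) ≤ qr k ^ 2 * (z a * zb a) ∧ 1 - zb k ≤ qr k * z a)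
    {φlo φhi slo shi ET : ℝ} (h12 : 0 ≤ w 1 a + w 2 a) (h3 : 0 ≤ w 3 a)
    (hX : 0 ≤ (w 1 a + w 2 a) * ((1 - z a) * (1 - zb a)) ^ φhi
      - apexRest (w 1) z zb a qd qr φlo ET - apexRest (w 2) z zb a qd qr φlo ET)
    (hY : 0 ≤ w 3 a * ((1 - z a) * (1 - zb a)) ^ shi - apexRest (w 3) z zb a qd qr slo ET)
    (hZ : (|w 5 a + w 6 a| * ((1 - z a) * (1 - zb a)) ^ ((φlo + slo) / 2)
            + apexRest (w 5) z zb a qd qr ((φlo + slo) / 2) ET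
            + apexRest (w 6) z zb a qd qr ((φlo + slo) / 2) ET) ^ 2 ≤
        4 * ((w 1 a + w 2 a) * ((1 - z a) * (1 - zb a)) ^ φhi
              - apexRest (w 1) z zb a qd qr φlo ET - apexRest (w 2) z zb a qd qr φlo ET) *
          (w 3 a * ((1 - z a) * (1 - zb a)) ^ shi - apexRest (w 3) z zb a qd qr slo ET)) :
    ∀ E : ℝ, ET ≤ E → ∀ j : ℕ, (j : ℝ) ≤ E → ∀ Δφ ∈ Icc φlo φhi, ∀ Δs ∈ Icc slo shi,
      ∀ x y : ℝ, 0 ≤ singletTermForm z zb w Δφ Δs E j x y := by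
  intro E hTE j hjE Δφ hφ Δs hσ x y
  set XT := (w 1 a + w 2 a) * ((1 - z a) * (1 - zb a)) ^ φhi
    - apexRest (w 1) z zb a qd qr φlo ET - apexRest (w 2) z zb a qd qr φlo ET
  set YT := w 3 a * ((1 - z a) * (1 - zb a)) ^ shi - apexRest (w 3) z zb a qd qr slo ET
  set ZT := |w 5 a + w 6 a| * ((1 - z a) * (1 - zb a)) ^ ((φlo + slo) / 2)
    + apexRest (w 5) z zb a qd qr ((φlo + slo) / 2) ET
    + apexRest (w 6) z zb a qd qr ((φlo + slo) / 2) ET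
  set P := zMono E j (z a) (zb a)
  have hP : 0 ≤ P := zMono_nonneg E j (hz a).1.le (hzb a).1.le
  have hva : 0 < (1 - z a) * (1 - zb a) ∧ (1 - z a) * (1 - zb a) ≤ 1 :=
    ⟨mul_pos (by linarith [(hz a).2]) (by linarith [(hzb a).2]),
      mul_le_one₀ (by linarith [(hz a).1]) (by linarith [(hzb a).2]) (by linarith [(hzb a).1])⟩
  have hqd0 : ∀ k, 0 < qd k := fun k => (hqd k).1
  have hqr0 : ∀ k, 0 < qr k := fun k => (hqr k).1
  have hqd0' : ∀ k, 0 ≤ qd k := fun k => (hqd k).1.le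
  have hqr0' : ∀ k, 0 ≤ qr k := fun k => (hqr k).1.le
  have hs : (φlo + slo) / 2 ≤ (Δφ + Δs) / 2 := by linarith [hφ.1, hσ.1]
  have hRle : ∀ (w' : Fin N → ℝ) {tlo t : ℝ}, tlo ≤ t →
      apexRest w' z zb a qd qr t E ≤ apexRest w' z zb a qd qr tlo ET := fun w' tlo t ht =>
    (apexRest_anti_exponent w' z zb hz hzb a qd qr hqd0' hqr0' ht E).trans
      (apexRest_anti_level w' z zb hz hzb a qd qr hqd hqr tlo hTE)
  -- X (two weights, signs -1 and +1)
  set X := pointFunctional (w 1) z zb (crossF Δφ (-1) (zMono E j)) +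
    pointFunctional (w 2) z zb (crossF Δφ 1 (zMono E j))
  have hb1 := apex_bounds_pointFunctional_crossF_zMono (w 1) z zb hz hzb hord a qd qr hqd0 hqr0 hdomd
    hdomr hjE Δφ (-1) (by norm_num)
  have hb2 := apex_bounds_pointFunctional_crossF_zMono (w 2) z zb hz hzb hord a qd qr hqd0 hqr0 hdomd
    hdomr hjE Δφ 1 (by norm_num)
  have hXle : P * XT ≤ X := by
    have hv : (w 1 a + w 2 a) * ((1 - z a) * (1 - zb a)) ^ φhi ≤
        (w 1 a + w 2 a) * ((1 - z a) * (1 - zb a)) ^ Δφ :=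
      mul_le_mul_of_nonneg_left (Real.rpow_le_rpow_of_exponent_ge hva.1 hva.2 hφ.2) h12
    have hR1 := hRle (w 1) hφ.1
    have hR2 := hRle (w 2) hφ.1
    have hlow : P * XT ≤ P * (w 1 a * ((1 - z a) * (1 - zb a)) ^ Δφ - apexRest (w 1) z zb a qd qr Δφ E)
        + P * (w 2 a * ((1 - z a) * (1 - zb a)) ^ Δφ - apexRest (w 2) z zb a qd qr Δφ E) := by
      rw [← mul_add]
      exact mul_le_mul_of_nonneg_left (by linarith) hP
    exact hlow.trans (add_le_add hb1.1 hb2.1)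
  -- Y
  have hb3 := apex_bounds_pointFunctional_crossF_zMono (w 3) z zb hz hzb hord a qd qr hqd0 hqr0 hdomd
    hdomr hjE Δs (-1) (by norm_num)
  have hYle : P * YT ≤ pointFunctional (w 3) z zb (crossF Δs (-1) (zMono E j)) := by
    refine le_trans (mul_le_mul_of_nonneg_left ?_ hP) hb3.1
    have hv : w 3 a * ((1 - z a) * (1 - zb a)) ^ shi ≤ w 3 a * ((1 - z a) * (1 - zb a)) ^ Δs :=
      mul_le_mul_of_nonneg_left (Real.rpow_le_rpow_of_exponent_ge hva.1 hva.2 hσ.2) h3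
    linarith [hRle (w 3) hσ.1]
  -- Z
  set Z := pointFunctional (w 5) z zb (crossF ((Δφ + Δs) / 2) (-1) (zMono E j)) +
    pointFunctional (w 6) z zb (crossF ((Δφ + Δs) / 2) 1 (zMono E j))
  have h5 := abs_pointFunctional_crossF_zMono_sub_apex_le (w 5) z zb hz hzb hord a qd qr hqd0 hqr0
    hdomd hdomr hjE ((Δφ + Δs) / 2) (-1) (by norm_num)
  have h6 := abs_pointFunctional_crossF_zMono_sub_apex_le (w 6) z zb hz hzb hord a qd qr hqd0 hqr0
    hdomd hdomr hjE ((Δφ + Δs) / 2) 1 (by norm_num)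
  have hvs : ((1 - z a) * (1 - zb a)) ^ ((Δφ + Δs) / 2) ≤ ((1 - z a) * (1 - zb a)) ^ ((φlo + slo) / 2) :=
    Real.rpow_le_rpow_of_exponent_ge hva.1 hva.2 hs
  have hvs0 : 0 ≤ ((1 - z a) * (1 - zb a)) ^ ((Δφ + Δs) / 2) := Real.rpow_nonneg hva.1.le _
  have hZabs : |Z| ≤ P * ZT := by
    have hsum : Z = (pointFunctional (w 5) z zb (crossF ((Δφ + Δs) / 2) (-1) (zMono E j)) -
        w 5 a * ((1 - z a) * (1 - zb a)) ^ ((Δφ + Δs) / 2) * P) +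
        (pointFunctional (w 6) z zb (crossF ((Δφ + Δs) / 2) 1 (zMono E j)) -
          w 6 a * ((1 - z a) * (1 - zb a)) ^ ((Δφ + Δs) / 2) * P) +
        (w 5 a + w 6 a) * ((1 - z a) * (1 - zb a)) ^ ((Δφ + Δs) / 2) * P := by ring
    have hlast : |(w 5 a + w 6 a) * ((1 - z a) * (1 - zb a)) ^ ((Δφ + Δs) / 2) * P| ≤
        |w 5 a + w 6 a| * ((1 - z a) * (1 - zb a)) ^ ((φlo + slo) / 2) * P := by
      rw [abs_mul, abs_mul, abs_of_nonneg hvs0, abs_of_nonneg hP]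
      exact mul_le_mul_of_nonneg_right (mul_le_mul_of_nonneg_left hvs (abs_nonneg _)) hP
    have hR5 := hRle (w 5) hs
    have hR6 := hRle (w 6) hs
    calc |Z| ≤ |pointFunctional (w 5) z zb (crossF ((Δφ + Δs) / 2) (-1) (zMono E j)) -
              w 5 a * ((1 - z a) * (1 - zb a)) ^ ((Δφ + Δs) / 2) * P| +
            |pointFunctional (w 6) z zb (crossF ((Δφ + Δs) / 2) 1 (zMono E j)) -
              w 6 a * ((1 - z a) * (1 - zb a)) ^ ((Δφ + Δs) / 2) * P| +
            |(w 5 a + w 6 a) * ((1 - z a) * (1 - zb a)) ^ ((Δφ + Δs) / 2) * P| := by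
          rw [hsum]; exact (abs_add_le _ _).trans (add_le_add (abs_add_le _ _) le_rfl)
      _ ≤ P * apexRest (w 5) z zb a qd qr ((Δφ + Δs) / 2) E +
            P * apexRest (w 6) z zb a qd qr ((Δφ + Δs) / 2) E +
            |w 5 a + w 6 a| * ((1 - z a) * (1 - zb a)) ^ ((φlo + slo) / 2) * P :=
          add_le_add (add_le_add h5 h6) hlast
      _ ≤ P * apexRest (w 5) z zb a qd qr ((φlo + slo) / 2) ET +
            P * apexRest (w 6) z zb a qd qr ((φlo + slo) / 2) ET +
            |w 5 a + w 6 a| * ((1 - z a) * (1 - zb a)) ^ ((φlo + slo) / 2) * P :=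
          add_le_add (add_le_add (mul_le_mul_of_nonneg_left hR5 hP)
            (mul_le_mul_of_nonneg_left hR6 hP)) le_rfl
      _ = P * ZT := by ring
  have hPX : 0 ≤ P * XT := mul_nonneg hP hX
  have hPY : 0 ≤ P * YT := mul_nonneg hP hY
  refine singletTermForm_nonneg_of_det z zb w (hPX.trans hXle) (hPY.trans hYle) ?_ x y
  have hZsq : Z ^ 2 ≤ (P * ZT) ^ 2 := by
    rw [← sq_abs Z]
    exact pow_le_pow_left₀ (abs_nonneg Z) hZabs 2
  calc Z ^ 2 ≤ (P * ZT) ^ 2 := hZsq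
    _ = P ^ 2 * ZT ^ 2 := by ring
    _ ≤ P ^ 2 * (4 * XT * YT) := mul_le_mul_of_nonneg_left hZ (sq_nonneg P)
    _ = 4 * (P * XT) * (P * YT) := by ring
    _ ≤ 4 * X * pointFunctional (w 3) z zb (crossF Δs (-1) (zMono E j)) :=
        mul_le_mul (mul_le_mul_of_nonneg_left hXle (by norm_num)) hYle hPY
          (mul_nonneg (by norm_num) (hPX.trans hXle))

/-! ### The singlet tail (S5) from (M) and (T) -/

/-- **(S5) at a regular point, twist-gap domain.** Termwise PSD of the singlet term form for
`E ∈ [E₀, E_T)`, `j + τ ≤ E` (rule (M), `τ ≤ 1`, `τ ≤ E₀`) and for `E ≥ E_T`, `j ≤ E` (rule (T)) give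
`SingletPositive` at every regular `(Δ, ℓ)` with `Δ ≥ E₀` above the unitarity bound.
[cite: HogervorstRychkov2013, §3 eq. (3.6)] -/
theorem tail_singletPositive_of_termwise_regular {N : ℕ} (z zb : Fin N → ℝ) (w : Fin 7 → Fin N → ℝ)
    (hz : ∀ k, z k ∈ Ioo (0 : ℝ) 1) (hzb : ∀ k, zb k ∈ Ioo (0 : ℝ) 1) {Δφ Δs E₀ ET τ : ℝ}
    (hτ1 : τ ≤ 1) (hτ0 : τ ≤ E₀)
    (hM : ∀ (j : ℕ) (E : ℝ), E₀ ≤ E → E < ET → (j : ℝ) + τ ≤ E →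
      ∀ x y : ℝ, 0 ≤ singletTermForm z zb w Δφ Δs E j x y)
    (hT : ∀ E : ℝ, ET ≤ E → ∀ j : ℕ, (j : ℝ) ≤ E → ∀ x y : ℝ, 0 ≤ singletTermForm z zb w Δφ Δs E j x y)
    {Δ : ℝ} {ℓ : ℕ} (hΔ : unitarityBound3D ℓ < Δ) (hreg : ¬ accidentalDegeneracy3D Δ ℓ)
    (hΔ0 : E₀ ≤ Δ) :
    (ofPoints z zb w).SingletPositive Δφ Δs Δ ℓ := by
  refine singletPositive_ofPoints_of_forall z zb w hz hzb hΔ hreg fun q hq x y => ?_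
  have hℓτ : (ℓ : ℝ) + τ ≤ Δ := natCast_add_le_of_unitarityBound3D_lt hτ1 hτ0 hΔ hΔ0
  have h1 : (q.2 : ℝ) ≤ (ℓ : ℝ) + (q.1 : ℝ) := by exact_mod_cast hq.2.1
  have hjE : (q.2 : ℝ) + τ ≤ Δ + (q.1 : ℝ) := by linarith
  have hjE' : (q.2 : ℝ) ≤ Δ + (q.1 : ℝ) := by
    linarith [natCast_add_half_le_unitarityBound3D ℓ]
  have hE0 : E₀ ≤ Δ + (q.1 : ℝ) := hΔ0.trans (le_add_of_nonneg_right (Nat.cast_nonneg _))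
  by_cases hlt : Δ + (q.1 : ℝ) < ET
  · exact hM q.2 (Δ + (q.1 : ℝ)) hE0 hlt hjE x y
  · exact hT (Δ + (q.1 : ℝ)) (not_lt.1 hlt) q.2 hjE' x y

/-- **(S5) on a box, all points.** As `tail_singletPositive_of_termwise_regular`, uniformly for
`(Δ_φ, Δ_s) ∈ Q ⊆ [φ_lo,φ_hi] × [s_lo,s_hi]`, with rule (T) discharged by the apex numbers of
`singletTermForm_nonneg_of_apex`, and at every `Δ ≥ E₀` with `unitarityBound3D ℓ ≤ Δ` (non-regular
points by right limits) — the item `tail_S` of `ArchipelagoObligations` for a point 7-vector.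
[cite: HogervorstRychkov2013, §3 eq. (3.6)] -/
theorem tail_singletPositive_of_boxes_and_apex {N : ℕ} (z zb : Fin N → ℝ) (w : Fin 7 → Fin N → ℝ)
    (hz : ∀ k, z k ∈ Ioo (0 : ℝ) 1) (hzb : ∀ k, zb k ∈ Ioo (0 : ℝ) 1) (hord : ∀ k, zb k ≤ z k)
    (a : Fin N) (qd qr : Fin N → ℝ) (hqd : ∀ k, 0 < qd k ∧ qd k ≤ 1)
    (hqr : ∀ k, 0 < qr k ∧ qr k ≤ 1)
    (hdomd : ∀ k, z k * zb k ≤ qd k ^ 2 * (z a * zb a) ∧ z k ≤ qd k * z a)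
    (hdomr : ∀ k, (1 - z k) * (1 - zb k) ≤ qr k ^ 2 * (z a * zb a) ∧ 1 - zb k ≤ qr k * z a)
    {Q : Set (ℝ × ℝ)} {φlo φhi slo shi E₀ ET τ : ℝ}
    (hQ : ∀ p ∈ Q, (φlo ≤ p.1 ∧ p.1 ≤ φhi) ∧ (slo ≤ p.2 ∧ p.2 ≤ shi))
    (hτ1 : τ ≤ 1) (hτ0 : τ ≤ E₀)
    (hM : ∀ (j : ℕ) (E : ℝ), E₀ ≤ E → E < ET → (j : ℝ) + τ ≤ E → ∀ p ∈ Q,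
      ∀ x y : ℝ, 0 ≤ singletTermForm z zb w p.1 p.2 E j x y)
    (h12 : 0 ≤ w 1 a + w 2 a) (h3 : 0 ≤ w 3 a)
    (hX : 0 ≤ (w 1 a + w 2 a) * ((1 - z a) * (1 - zb a)) ^ φhi
      - apexRest (w 1) z zb a qd qr φlo ET - apexRest (w 2) z zb a qd qr φlo ET)
    (hY : 0 ≤ w 3 a * ((1 - z a) * (1 - zb a)) ^ shi - apexRest (w 3) z zb a qd qr slo ET)
    (hZ : (|w 5 a + w 6 a| * ((1 - z a) * (1 - zb a)) ^ ((φlo + slo) / 2)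
            + apexRest (w 5) z zb a qd qr ((φlo + slo) / 2) ET
            + apexRest (w 6) z zb a qd qr ((φlo + slo) / 2) ET) ^ 2 ≤
        4 * ((w 1 a + w 2 a) * ((1 - z a) * (1 - zb a)) ^ φhi
              - apexRest (w 1) z zb a qd qr φlo ET - apexRest (w 2) z zb a qd qr φlo ET) *
          (w 3 a * ((1 - z a) * (1 - zb a)) ^ shi - apexRest (w 3) z zb a qd qr slo ET)) :
    ∀ p ∈ Q, ∀ ℓ : ℕ, ∀ Δ : ℝ, unitarityBound3D ℓ ≤ Δ → E₀ ≤ Δ →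
      (ofPoints z zb w).SingletPositive p.1 p.2 Δ ℓ := by
  intro p hp ℓ Δ hbd hΔ0
  have hT := singletTermForm_nonneg_of_apex z zb w hz hzb hord a qd qr hqd hqr hdomd hdomr h12 h3 hX
    hY hZ
  have hTp : ∀ E : ℝ, ET ≤ E → ∀ j : ℕ, (j : ℝ) ≤ E → ∀ x y : ℝ,
      0 ≤ singletTermForm z zb w p.1 p.2 E j x y :=
    fun E hE j hj x y => hT E hE j hj p.1 ⟨(hQ p hp).1.1, (hQ p hp).1.2⟩ p.2
      ⟨(hQ p hp).2.1, (hQ p hp).2.2⟩ x y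
  have hMp : ∀ (j : ℕ) (E : ℝ), E₀ ≤ E → E < ET → (j : ℝ) + τ ≤ E →
      ∀ x y : ℝ, 0 ≤ singletTermForm z zb w p.1 p.2 E j x y :=
    fun j E hE hlt hj x y => hM j E hE hlt hj p hp x y
  by_cases hregpt : IsRegularPoint3D Δ ℓ
  · exact tail_singletPositive_of_termwise_regular z zb w hz hzb hτ1 hτ0 hMp hTp
      (lt_of_le_of_ne hbd (Ne.symm hregpt.1)) hregpt.2 hΔ0
  · refine singletPositive_ofPoints_of_eventually_right z zb w hz hzb p.1 p.2 Δ ℓ hregpt ?_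
    filter_upwards [eventually_isRegularPoint3D_nhdsGT_of_bound_le hbd, self_mem_nhdsWithin]
      with Δ' hΔ' hgt
    have hgt' : Δ < Δ' := Set.mem_Ioi.1 hgt
    exact ⟨hΔ', tail_singletPositive_of_termwise_regular z zb w hz hzb hτ1 hτ0 hMp hTp
      (lt_of_le_of_lt hbd hgt') hΔ'.2 (hΔ0.trans hgt'.le)⟩

/-! ### The schema of an archipelago point certificate -/

/-- **The `S` sector from light obligations and the closed-form tail**: singlet scalars on
`[max(Δ_S^*, 1/2), E₀)`, even non-zero spins on `[ℓ+1, E₀)`, and the tail `Δ ≥ E₀` (every spin) give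
clause (v) of `IsPositiveAt` at every point of `Q`. Elementary. [cite: KosPolandSimmonsDuffinVichi2015, §2.2 (functional conditions)] -/
theorem singlet_clause_of_light_and_tail (α : ArchipelagoFunctional) {A : ArchipelagoGaps}
    {Q : Set (ℝ × ℝ)} {E₀ : ℝ}
    (hS3 : ∀ p ∈ Q, ∀ Δ : ℝ, A.ΔSstar ≤ Δ → 1 / 2 ≤ Δ → Δ < E₀ → α.SingletPositive p.1 p.2 Δ 0)
    (hS4 : ∀ p ∈ Q, ∀ ℓ : ℕ, Even ℓ → ℓ ≠ 0 → ∀ Δ : ℝ, (ℓ : ℝ) + 1 ≤ Δ → Δ < E₀ →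
      α.SingletPositive p.1 p.2 Δ ℓ)
    (hS5 : ∀ p ∈ Q, ∀ ℓ : ℕ, ∀ Δ : ℝ, unitarityBound3D ℓ ≤ Δ → E₀ ≤ Δ → α.SingletPositive p.1 p.2 Δ ℓ) :
    ∀ p ∈ Q, ∀ (Δ : ℝ) (ℓ : ℕ) (g : ℝ → ℝ → ℝ), Even ℓ → unitarityBound3D ℓ ≤ Δ →
      (ℓ = 0 → A.ΔSstar ≤ Δ) → IsConformalBlock3D 0 0 Δ ℓ g → ∀ a b : ℝ, 0 ≤ α.singletForm p.1 p.2 g a b := by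
  intro p hp Δ ℓ g hℓ hb hgap hg a b
  rcases lt_or_ge Δ E₀ with hlt | hge
  · by_cases h0 : ℓ = 0
    · subst h0
      have hb0 : unitarityBound3D 0 = 1 / 2 := by simp [unitarityBound3D]
      rw [hb0] at hb
      exact hS3 p hp Δ (hgap rfl) hb hlt g hg a b
    · have hb' : (ℓ : ℝ) + 1 ≤ Δ := by simpa [unitarityBound3D, h0] using hb
      exact hS4 p hp ℓ hℓ h0 Δ hb' hlt g hg a b
  · exact hS5 p hp ℓ Δ hb hge g hg a b

/-- **The archipelago point-certificate schema** (singlet sector closed-form; `T`, `A`, `V` rows and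
the external form as obligations).  Nodes in the open square with `z̄_k ≤ z_k`, a dominating apex `a`
(`qd_k, qr_k ∈ (0,1]`), `Q ⊆ [φ_lo,φ_hi] × [s_lo,s_hi]`.  Then: (I) the identity number `> 0`; the `T`
rows (even spins, scalars from `Δ_T^*`), the `A` rows (odd spins), the `V` rows (all spins, scalars from
`Δ_V^*`) and the external form as hypotheses in the shape of `IsPositiveAt` (served by `TwoSignRows`,
by the `σ–ε` odd chain through `vectorPositive_ofPoints_iff`, and by `extPositive_of_separate` or a
direct `2×2` check); (S3)/(S4) the light singlets below `E₀` (hypotheses; cell tables); (M) singlet term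
forms PSD on `E ∈ [E₀, E_T)`, `j + τ ≤ E` box by box (`singletTermForm_nonneg_of_cornerBounds`);
(T) the three apex numbers — give `BoxExcluded N A Q`. [cite: KosPolandSimmonsDuffinVichi2015, §2.2 (functional conditions)] -/
theorem boxExcluded_of_archipelagoPointRules {N n : ℕ} {z zb : Fin n → ℝ} {w : Fin 7 → Fin n → ℝ}
    (hz : ∀ k, z k ∈ Ioo (0 : ℝ) 1) (hzb : ∀ k, zb k ∈ Ioo (0 : ℝ) 1) (hord : ∀ k, zb k ≤ z k)
    (a : Fin n) (qd qr : Fin n → ℝ) (hqd : ∀ k, 0 < qd k ∧ qd k ≤ 1)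
    (hqr : ∀ k, 0 < qr k ∧ qr k ≤ 1)
    (hdomd : ∀ k, z k * zb k ≤ qd k ^ 2 * (z a * zb a) ∧ z k ≤ qd k * z a)
    (hdomr : ∀ k, (1 - z k) * (1 - zb k) ≤ qr k ^ 2 * (z a * zb a) ∧ 1 - zb k ≤ qr k * z a)
    {A : ArchipelagoGaps} {Q : Set (ℝ × ℝ)} {φlo φhi slo shi E₀ ET τ : ℝ}
    (hQ : ∀ p ∈ Q, (φlo ≤ p.1 ∧ p.1 ≤ φhi) ∧ (slo ≤ p.2 ∧ p.2 ≤ shi))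
    (hτ1 : τ ≤ 1) (hτ0 : τ ≤ E₀)
    (hI : 0 < cornerBound₂ (w 1 + w 2) (w 1 - w 2) z zb 0 0 0 φlo φhi +
      termCornerBound (w 3) z zb 0 0 0 slo shi +
      cornerBound₂ (w 5 + w 6) (w 5 - w 6) z zb 0 0 0 ((φlo + slo) / 2) ((φhi + shi) / 2))
    (hT : ∀ p ∈ Q, ∀ (Δ : ℝ) (ℓ : ℕ), Even ℓ → unitarityBound3D ℓ ≤ Δ → (ℓ = 0 → A.ΔTstar ≤ Δ) →
      (ofPoints z zb w).TensorPositive N p.1 Δ ℓ)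
    (hA : ∀ p ∈ Q, ∀ (Δ : ℝ) (ℓ : ℕ), Odd ℓ → unitarityBound3D ℓ ≤ Δ → (ofPoints z zb w).AntiPositive p.1 Δ ℓ)
    (hV : ∀ p ∈ Q, ∀ (Δ : ℝ) (ℓ : ℕ), unitarityBound3D ℓ ≤ Δ → (ℓ = 0 → A.ΔVstar ≤ Δ) →
      (ofPoints z zb w).VectorPositive p.1 p.2 Δ ℓ)
    (hext : ∀ p ∈ Q, (ofPoints z zb w).ExtPositive p.1 p.2)
    (hS3 : ∀ p ∈ Q, ∀ Δ : ℝ, A.ΔSstar ≤ Δ → 1 / 2 ≤ Δ → Δ < E₀ →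
      (ofPoints z zb w).SingletPositive p.1 p.2 Δ 0)
    (hS4 : ∀ p ∈ Q, ∀ ℓ : ℕ, Even ℓ → ℓ ≠ 0 → ∀ Δ : ℝ, (ℓ : ℝ) + 1 ≤ Δ → Δ < E₀ →
      (ofPoints z zb w).SingletPositive p.1 p.2 Δ ℓ)
    (hM : ∀ (j : ℕ) (E : ℝ), E₀ ≤ E → E < ET → (j : ℝ) + τ ≤ E → ∀ p ∈ Q,
      ∀ x y : ℝ, 0 ≤ singletTermForm z zb w p.1 p.2 E j x y)
    (h12 : 0 ≤ w 1 a + w 2 a) (h3 : 0 ≤ w 3 a)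
    (hX : 0 ≤ (w 1 a + w 2 a) * ((1 - z a) * (1 - zb a)) ^ φhi
      - apexRest (w 1) z zb a qd qr φlo ET - apexRest (w 2) z zb a qd qr φlo ET)
    (hY : 0 ≤ w 3 a * ((1 - z a) * (1 - zb a)) ^ shi - apexRest (w 3) z zb a qd qr slo ET)
    (hZ : (|w 5 a + w 6 a| * ((1 - z a) * (1 - zb a)) ^ ((φlo + slo) / 2)
            + apexRest (w 5) z zb a qd qr ((φlo + slo) / 2) ET
            + apexRest (w 6) z zb a qd qr ((φlo + slo) / 2) ET) ^ 2 ≤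
        4 * ((w 1 a + w 2 a) * ((1 - z a) * (1 - zb a)) ^ φhi
              - apexRest (w 1) z zb a qd qr φlo ET - apexRest (w 2) z zb a qd qr φlo ET) *
          (w 3 a * ((1 - z a) * (1 - zb a)) ^ shi - apexRest (w 3) z zb a qd qr slo ET)) :
    BoxExcluded N A Q := by
  have hS5 := tail_singletPositive_of_boxes_and_apex z zb w hz hzb hord a qd qr hqd hqr hdomd hdomr hQ
    hτ1 hτ0 hM h12 h3 hX hY hZ
  have hS := singlet_clause_of_light_and_tail (ofPoints z zb w) hS3 hS4 hS5
  have hIpos := identityTerm_ofPoints_pos_of_cornerBounds z zb w hz hzb hQ hI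
  refine boxExcluded_of_pointFunctional A z zb w hz hzb Q fun p hp => ⟨hIpos p hp, ?_, ?_, ?_, hS p hp, hext p hp⟩
  · exact fun Δ ℓ g hℓ hb hgap hg => hT p hp Δ ℓ hℓ hb hgap g hg
  · exact fun Δ ℓ g hℓ hb hg => hA p hp Δ ℓ hℓ hb g hg
  · exact fun Δ ℓ g₁ g₂ hb hgap hg₁ hg₂ => hV p hp Δ ℓ hb hgap g₁ g₂ hg₁ hg₂

end ArchipelagoFunctional

end Literature.MathematicalPhysics.QuantumFieldTheory.ONArchipelagoSystem
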